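import Summits.HodgeConjecture.HodgeConjecture.Theorems.K2E3UnitaryParabolicLeviPart
import Literature.NumberTheory.Automorphic.UnitaryGroupRayJacquetCriterionAnyRank
import Literature.NumberTheory.Automorphic.UnipotentRadicalCompactOpenProofs
import HarnessLib

/-!
# K2 ∕ E3 «EllipticInputs», 13a road A, J1-lite (generic half): RAY LEVELS of a BLOCK radical `N_c ∩ U` of the quasi-split unitary group
# `U(σ, Φ_N)(K)` contracted by a diagonal element whose ratios are `≤ 1` everywhere and `≤ q < 1` ACROSS the blocks

Cell `hodgecm-mathlib` (Track B «K2-LIT»), item h413 = `stmt-HodgeConjecture-24833`; author K2E3-p10 (g2); count-neutral helper for the 13a line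
(road A; the binders `Nf ∕ hmono ∕ hexh ∕ hsmall ∕ hcontr ∕ hpres` of the cone criterion ★ `Representation.isSupercuspidal_of_subsingleton_coinvariants_of_cartan_pi`
for the Witt radicals `N_α = wittRadical … (univ.erase α)` and the Witt cocharacters; this file is the GENERIC half — any labelling `c : Fin N → α'`
MONOTONE in the position order (★ `K2E3WittStandardIndexing.monotone_wittBlockOn_of_std`), any diagonal `s ∈ U` whose ratios are `≤ q` ACROSS the blocks (no hypothesis within a block: those entries of `N ∩ U_c` vanish); the Witt-specific ratio facts
(`|σϖ| = |ϖ| < 1`) are the sequel).  PROOF lane: theorems only (no `def`, no `instance`, no `sorry`); the setting, names and proofs follow ★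
`UnitaryGroupRayJacquetCriterionAnyRank` (K2E3-free; rank-free Casselman contraction), with the Borel radical `N` replaced by `N ∩ U_c`.

* §1 **`diag_conj_mem_of_blockRadical`** — `s = diag(u) ∈ U` with `|u_i∕u_j| ≤ 1` (`i < j`) and `≤ q'` when moreover `c i < c j`; `x ∈ N ∩ U_c` with
  `q'·|(x−1)_{ij}| ≤ γ' < 1` across blocks ⇒ `s x s⁻¹ ∈ K_{γ'} ∩ N ∩ U_c` (within a block `(x−1)_{ij} = 0`: identity diagonal blocks).
* §2 the ray levels `Nf j := t^{-j}(K_γ ∩ N ∩ U_c)t^{j}`: `blockRayLevel_mono`, `conj_mem_blockRayLevel` (`hcontr`), `conj_mem_blockRayLevel_of_ratio_le_one`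
  (`hpres` for any diagonal `t' ∈ U` with ratios `≤ 1` commuting with `t`), and over a non-archimedean local field `exists_mem_blockRayLevel` (`hexh`),
  `exists_blockRayLevel_subset` (`hsmall`).

References: W. Casselman (1995), Prop. 1.4.4, Thm. 5.3.1; I. N. Bernstein, A. V. Zelevinsky (1976), §3.18–3.21; (1977), §1.8–1.9.
-/

set_option autoImplicit false
set_option linter.dupNamespace false

open scoped MatrixGroups Pointwise Topology
open ValuativeRel Matrix

namespace Summit.HodgeConjecture.HodgeConjecture.Cruxes.H413.K2E3BlockRadicalRayLevels

open Literature.NumberTheory.Automorphic Literature.NumberTheory.Automorphic.UnitaryGroup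
open Literature.NumberTheory.Automorphic.UnitaryGroup.AnyRank

/-! ## §1 Conjugating `K_γ ∩ N ∩ U_c` by a diagonal element with ratios `≤ 1`, `≤ q'` across blocks -/

section RayAlg

variable {K : Type*} [Field K] [ValuativeRel K] (σ : K →+* K) {N : ℕ} {J : Matrix (Fin N) (Fin N) K}
  (hJ : J = (StdForm.antidiagonal N).over K) {α' : Type*} [LinearOrder α'] [Fintype α'] (c : Fin N → α') (hcm : Monotone c)

include hcm in
/-- **Block-radical contraction**: `s = diag(u) ∈ U` with `|u_i∕u_j| ≤ 1` for `i < j` and `≤ q'` when `c i < c j`; `x ∈ N ∩ U_c` (upper unitriangular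
with identity `c`-diagonal blocks) with `q'·|(x−1)_{ij}| ≤ γ' < 1` whenever `i < j`, `c i < c j` ⇒ `s x s⁻¹ ∈ K_{γ'} ∩ N`, and `s x s⁻¹ ∈ U_c`.
[cite: Casselman1995, Prop. 1.4.4; proof of Thm. 5.3.1] -/
theorem diag_conj_mem_of_blockRadical {q' γ' : ValueGroupWithZero K} (hγ' : γ' < 1) (s : ↥(unitaryGroupOfForm σ J)) (u : Fin N → Kˣ)
    (hs : ((s : ↥(unitaryGroupOfForm σ J)) : GL (Fin N) K) = glDiagonal N K u)
    (huq : ∀ i j : Fin N, i < j → c i < c j → valuation K ((u i : K) * ((u j : K))⁻¹) ≤ q')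
    {x : ↥(unitaryGroupOfForm σ J)} (hxN : x ∈ (borelTriple σ J hJ).N)
    (hxc : ((x : ↥(unitaryGroupOfForm σ J)) : GL (Fin N) K) ∈ unipotentRadicalGL K c)
    (hxb : ∀ i j : Fin N, i < j → c i < c j →
      q' * valuation K (((((x : ↥(unitaryGroupOfForm σ J)) : GL (Fin N) K) : Matrix (Fin N) (Fin N) K) - 1) i j) ≤ γ') :
    s * x * s⁻¹ ∈ (congruenceGL N γ').comap (unitaryGroupOfForm σ J).subtype ⊓ (borelTriple σ J hJ).N ∧
      (((s * x * s⁻¹ : ↥(unitaryGroupOfForm σ J))) : GL (Fin N) K) ∈ unipotentRadicalGL K c := by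
  have hxN' : ((x : ↥(unitaryGroupOfForm σ J)) : GL (Fin N) K) ∈ upperUnitriangular (Fin N) K := hxN
  obtain ⟨htri, hdiag⟩ := (mem_upperUnitriangular_iff _).1 hxN'
  obtain ⟨-, hcdiag⟩ := (mem_unipotentRadicalGL_iff_entry c _).1 hxc
  refine ⟨Subgroup.mem_inf.2 ⟨?_, ?_⟩, ?_⟩
  · show (((s * x * s⁻¹ : ↥(unitaryGroupOfForm σ J))) : GL (Fin N) K) ∈ congruenceGL N γ'
    rw [Subgroup.coe_mul, Subgroup.coe_mul, Subgroup.coe_inv, hs]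
    refine mem_congruenceGL_of_valBound_sub_one hγ' fun i j => ?_
    rw [coe_glDiagonal_mul_mul_inv_sub_one_apply, map_mul]
    rcases lt_or_ge i j with hij | hij
    · rcases (hcm hij.le).lt_or_eq with hc | hc
      · exact le_trans (mul_le_mul' (huq i j hij hc) le_rfl) (hxb i j hij hc)
      · -- same block: `(x - 1)_{ij} = 0`
        have h0 : ((((x : ↥(unitaryGroupOfForm σ J)) : GL (Fin N) K) : Matrix (Fin N) (Fin N) K) - 1) i j = 0 := by
          rw [Matrix.sub_apply, hcdiag i j hc, sub_self]
        rw [h0, map_zero, mul_zero]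
        exact zero_le
    · have h0 : ((((x : ↥(unitaryGroupOfForm σ J)) : GL (Fin N) K) : Matrix (Fin N) (Fin N) K) - 1) i j = 0 := by
        rw [Matrix.sub_apply]
        rcases lt_or_eq_of_le hij with hlt | heq
        · rw [htri hlt, Matrix.one_apply_ne (ne_of_gt hlt), sub_zero]
        · rw [heq, hdiag, Matrix.one_apply_eq, sub_self]
      rw [h0, map_zero, mul_zero]
      exact zero_le
  · exact (borelTriple σ J hJ).normal_subgroupOf.conj_mem ⟨x, (borelTriple σ J hJ).N_le hxN⟩ hxN
      ⟨s, (borelTriple σ J hJ).M_le (by rw [borelTriple_M, mem_torusU_iff]; exact ⟨u, hs.symm⟩)⟩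
  · -- `s ∈ P_c` (diagonal) normalises `U_c`
    have hsP : ((s : ↥(unitaryGroupOfForm σ J)) : GL (Fin N) K) ∈ standardParabolicGL K c := by
      rw [mem_standardParabolicGL_iff, hs, coe_glDiagonal]
      exact Matrix.blockTriangular_diagonal _
    have hnorm := K2E3UnitaryParabolicLeviPart.le_normalizer_parabolic_unitary σ c J
      (Subgroup.mem_comap.2 hsP : s ∈ (standardParabolicGL K c).comap (unitaryGroupOfForm σ J).subtype)
    rw [Subgroup.mem_normalizer_iff] at hnorm
    have := (hnorm x).1 (Subgroup.mem_comap.2 hxc)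
    exact Subgroup.mem_comap.1 this

include hcm in
/-- The special case `x ∈ K_γ ∩ N ∩ U_c`, `q'·γ ≤ γ' < 1`. [cite: Casselman1995, Prop. 1.4.4] -/
theorem diag_conj_mem_of_mem_blockRadical {q' γ γ' : ValueGroupWithZero K} (hγ' : γ' < 1) (hqγ : q' * γ ≤ γ') (s : ↥(unitaryGroupOfForm σ J))
    (u : Fin N → Kˣ) (hs : ((s : ↥(unitaryGroupOfForm σ J)) : GL (Fin N) K) = glDiagonal N K u)
    (huq : ∀ i j : Fin N, i < j → c i < c j → valuation K ((u i : K) * ((u j : K))⁻¹) ≤ q')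
    {x : ↥(unitaryGroupOfForm σ J)}
    (hx : x ∈ (congruenceGL N γ).comap (unitaryGroupOfForm σ J).subtype ⊓ (borelTriple σ J hJ).N ⊓
      (unipotentRadicalGL K c).comap (unitaryGroupOfForm σ J).subtype) :
    s * x * s⁻¹ ∈ (congruenceGL N γ').comap (unitaryGroupOfForm σ J).subtype ⊓ (borelTriple σ J hJ).N ⊓
      (unipotentRadicalGL K c).comap (unitaryGroupOfForm σ J).subtype := by
  obtain ⟨hx1, hxc⟩ := Subgroup.mem_inf.1 hx
  obtain ⟨hxK, hxN⟩ := Subgroup.mem_inf.1 hx1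
  obtain ⟨h1, h2⟩ := diag_conj_mem_of_blockRadical σ hJ c hcm hγ' s u hs huq hxN (Subgroup.mem_comap.1 hxc)
    fun i j _ _ => le_trans (mul_le_mul' le_rfl (((mem_congruenceGL_iff.1 hxK).2.1) i j)) hqγ
  exact Subgroup.mem_inf.2 ⟨h1, Subgroup.mem_comap.2 h2⟩

/-! ## §2 The block ray levels `t^{-j}(K_γ ∩ N ∩ U_c)t^{j}`: monotone, contracted by `t`, preserved by commuting diagonal `t'` -/

include hcm in
/-- **The block ray levels increase**: `t^{-j}(K_γ ∩ N ∩ U_c)t^{j} ≤ t^{-(j+1)}(…)t^{j+1}` for `t = diag(w)` with ratios `≤ 1` (`1·γ ≤ γ`).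
[cite: BernsteinZelevinsky1976, §3.18–3.21] [cite: Casselman1995, Prop. 1.4.4] -/
theorem blockRayLevel_mono {γ : ValueGroupWithZero K} (hγ : γ < 1) (t : ↥(unitaryGroupOfForm σ J)) (w : Fin N → Kˣ)
    (ht : ((t : ↥(unitaryGroupOfForm σ J)) : GL (Fin N) K) = glDiagonal N K w) (hw : ∀ i j : Fin N, i < j → valuation K ((w i : K) * ((w j : K))⁻¹) ≤ 1)
    (j : ℤ) :
    ((congruenceGL N γ).comap (unitaryGroupOfForm σ J).subtype ⊓ (borelTriple σ J hJ).N ⊓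
        (unipotentRadicalGL K c).comap (unitaryGroupOfForm σ J).subtype).map (MulAut.conj (t ^ (-j))).toMonoidHom ≤
      ((congruenceGL N γ).comap (unitaryGroupOfForm σ J).subtype ⊓ (borelTriple σ J hJ).N ⊓
        (unipotentRadicalGL K c).comap (unitaryGroupOfForm σ J).subtype).map (MulAut.conj (t ^ (-(j + 1)))).toMonoidHom := by
  intro y hy
  rw [mem_map_conj_zpow_neg_iff] at hy ⊢
  have hre : t ^ (j + 1) * y * t ^ (-(j + 1)) = t * (t ^ j * y * t ^ (-j)) * t⁻¹ := by group
  rw [hre]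
  exact diag_conj_mem_of_mem_blockRadical σ hJ c hcm hγ (by rw [one_mul]) t w ht (fun i j hij _ => hw i j hij) hy

omit [Fintype α'] in
/-- **`t` contracts the block ray levels** (`hcontr`; definitional re-bracketing). [cite: BernsteinZelevinsky1976, §3.18–3.21] -/
theorem conj_mem_blockRayLevel {γ : ValueGroupWithZero K} (t : ↥(unitaryGroupOfForm σ J)) (j : ℤ) {u : ↥(unitaryGroupOfForm σ J)}
    (hu : u ∈ ((congruenceGL N γ).comap (unitaryGroupOfForm σ J).subtype ⊓ (borelTriple σ J hJ).N ⊓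
      (unipotentRadicalGL K c).comap (unitaryGroupOfForm σ J).subtype).map (MulAut.conj (t ^ (-(j + 1)))).toMonoidHom) :
    t * u * t⁻¹ ∈ ((congruenceGL N γ).comap (unitaryGroupOfForm σ J).subtype ⊓ (borelTriple σ J hJ).N ⊓
      (unipotentRadicalGL K c).comap (unitaryGroupOfForm σ J).subtype).map (MulAut.conj (t ^ (-j))).toMonoidHom := by
  rw [mem_map_conj_zpow_neg_iff] at hu ⊢
  have hre : t ^ j * (t * u * t⁻¹) * t ^ (-j) = t ^ (j + 1) * u * t ^ (-(j + 1)) := by group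
  rw [hre]
  exact hu

include hcm in
/-- **A commuting diagonal `t'` with ratios `≤ 1` preserves the block ray levels of `t`** (`hpres`). [cite: Casselman1995, Prop. 1.4.4] -/
theorem conj_mem_blockRayLevel_of_ratio_le_one {γ : ValueGroupWithZero K} (hγ : γ < 1) (t t' : ↥(unitaryGroupOfForm σ J))
    (hcomm : Commute t t') (w' : Fin N → Kˣ) (ht' : ((t' : ↥(unitaryGroupOfForm σ J)) : GL (Fin N) K) = glDiagonal N K w')
    (hw' : ∀ i j : Fin N, i < j → valuation K ((w' i : K) * ((w' j : K))⁻¹) ≤ 1) (j : ℤ) {u : ↥(unitaryGroupOfForm σ J)}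
    (hu : u ∈ ((congruenceGL N γ).comap (unitaryGroupOfForm σ J).subtype ⊓ (borelTriple σ J hJ).N ⊓
      (unipotentRadicalGL K c).comap (unitaryGroupOfForm σ J).subtype).map (MulAut.conj (t ^ (-j))).toMonoidHom) :
    t' * u * t'⁻¹ ∈ ((congruenceGL N γ).comap (unitaryGroupOfForm σ J).subtype ⊓ (borelTriple σ J hJ).N ⊓
      (unipotentRadicalGL K c).comap (unitaryGroupOfForm σ J).subtype).map (MulAut.conj (t ^ (-j))).toMonoidHom := by
  rw [mem_map_conj_zpow_neg_iff] at hu ⊢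
  have hc1 : Commute (t ^ j) t' := hcomm.zpow_left j
  have hc2 : Commute (t ^ (-j)) t' := hcomm.zpow_left (-j)
  have hre : t ^ j * (t' * u * t'⁻¹) * t ^ (-j) = t' * (t ^ j * u * t ^ (-j)) * t'⁻¹ := by
    calc t ^ j * (t' * u * t'⁻¹) * t ^ (-j) = (t ^ j * t') * u * (t'⁻¹ * t ^ (-j)) := by group
      _ = (t' * t ^ j) * u * (t ^ (-j) * t'⁻¹) := by rw [hc1.eq, ← hc2.inv_right.eq]
      _ = t' * (t ^ j * u * t ^ (-j)) * t'⁻¹ := by group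
  rw [hre]
  exact diag_conj_mem_of_mem_blockRadical σ hJ c hcm hγ (by rw [one_mul]) t' w' ht' (fun i j hij _ => hw' i j hij) hu

end RayAlg

/-! ## §3 Exhaustion and smallness over a non-archimedean local field -/

section RayTop

variable {K : Type*} [Field K] [ValuativeRel K] [TopologicalSpace K] [IsNonarchimedeanLocalField K]
  (σ : K →+* K) {N : ℕ} {J : Matrix (Fin N) (Fin N) K} (hJ : J = (StdForm.antidiagonal N).over K)
  {α' : Type*} [LinearOrder α'] [Fintype α'] (c : Fin N → α') (hcm : Monotone c)

include hcm in
/-- **The block ray levels exhaust `N ∩ U_c`** (`hexh`): every `u ∈ N ∩ U_c` lies in `t^{-m}(K_γ ∩ N ∩ U_c)t^{m}` for `m` large, for `t = diag(w)` with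
ratios `≤ 1` and `≤ q < 1` across blocks. [cite: BernsteinZelevinsky1977, §1.9] [cite: Casselman1995, proof of Thm. 5.3.1] -/
theorem exists_mem_blockRayLevel {q : ValueGroupWithZero K} (hq0 : q ≠ 0) (hq1 : q < 1) {γ : ValueGroupWithZero K} (hγ0 : γ ≠ 0) (hγ : γ < 1)
    (t : ↥(unitaryGroupOfForm σ J)) (w : Fin N → Kˣ) (ht : ((t : ↥(unitaryGroupOfForm σ J)) : GL (Fin N) K) = glDiagonal N K w)
    (hwq : ∀ i j : Fin N, i < j → c i < c j → valuation K ((w i : K) * ((w j : K))⁻¹) ≤ q)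
    {u : ↥(unitaryGroupOfForm σ J)} (hu : u ∈ (borelTriple σ J hJ).N)
    (huc : ((u : ↥(unitaryGroupOfForm σ J)) : GL (Fin N) K) ∈ unipotentRadicalGL K c) :
    ∃ j : ℤ, u ∈ ((congruenceGL N γ).comap (unitaryGroupOfForm σ J).subtype ⊓ (borelTriple σ J hJ).N ⊓
      (unipotentRadicalGL K c).comap (unitaryGroupOfForm σ J).subtype).map (MulAut.conj (t ^ (-j))).toMonoidHom := by
  classical
  obtain ⟨Γ, hΓ⟩ : ∃ Γ : ValueGroupWithZero K, ∀ i j,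
      valuation K (((((u : ↥(unitaryGroupOfForm σ J)) : GL (Fin N) K) : Matrix (Fin N) (Fin N) K) - 1) i j) ≤ Γ :=
    ⟨Finset.univ.sup fun p : Fin N × Fin N => valuation K (((((u : ↥(unitaryGroupOfForm σ J)) : GL (Fin N) K) : Matrix (Fin N) (Fin N) K) - 1) p.1 p.2),
      fun i j => Finset.le_sup (f := fun p : Fin N × Fin N =>
        valuation K (((((u : ↥(unitaryGroupOfForm σ J)) : GL (Fin N) K) : Matrix (Fin N) (Fin N) K) - 1) p.1 p.2)) (Finset.mem_univ (i, j))⟩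
  obtain ⟨m, hm⟩ := exists_pow_mul_le hq0 hq1 Γ hγ0
  refine ⟨(m : ℤ), ?_⟩
  rw [mem_map_conj_zpow_neg_iff, _root_.zpow_neg, zpow_natCast]
  have hwqm : ∀ i j : Fin N, i < j → c i < c j → valuation K (((w ^ m) i : K) * (((w ^ m) j : K))⁻¹) ≤ q ^ m := fun i j hij hc => by
    rw [Pi.pow_apply, Pi.pow_apply, Units.val_pow_eq_pow_val, Units.val_pow_eq_pow_val, ← inv_pow, ← mul_pow, map_pow]
    exact pow_le_pow_left₀ zero_le (hwq i j hij hc) m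
  obtain ⟨h1, h2⟩ := diag_conj_mem_of_blockRadical σ hJ c hcm hγ (t ^ m) (w ^ m) (coe_pow_eq_glDiagonal_pow σ t w ht m) hwqm hu huc
    (fun i j _ _ => le_trans (mul_le_mul' le_rfl (hΓ i j)) hm)
  exact Subgroup.mem_inf.2 ⟨h1, Subgroup.mem_comap.2 h2⟩

include hcm in
/-- **The block ray levels shrink to `1`** (`hsmall`): every neighbourhood of `1` in `U` contains `t^{m}(K_γ ∩ N ∩ U_c)t^{-m}` for `m` large.
[cite: BernsteinZelevinsky1976, §3.18–3.21] [cite: Casselman1995, Prop. 1.4.4] -/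
theorem exists_blockRayLevel_subset {q : ValueGroupWithZero K} (hq0 : q ≠ 0) (hq1 : q < 1) {γ : ValueGroupWithZero K} (hγ0 : γ ≠ 0) (hγ : γ < 1)
    (t : ↥(unitaryGroupOfForm σ J)) (w : Fin N → Kˣ) (ht : ((t : ↥(unitaryGroupOfForm σ J)) : GL (Fin N) K) = glDiagonal N K w)
    (hwq : ∀ i j : Fin N, i < j → c i < c j → valuation K ((w i : K) * ((w j : K))⁻¹) ≤ q)
    {O : Set ↥(unitaryGroupOfForm σ J)} (hO : O ∈ 𝓝 (1 : ↥(unitaryGroupOfForm σ J))) :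
    ∃ j : ℤ, ((((congruenceGL N γ).comap (unitaryGroupOfForm σ J).subtype ⊓ (borelTriple σ J hJ).N ⊓
      (unipotentRadicalGL K c).comap (unitaryGroupOfForm σ J).subtype).map (MulAut.conj (t ^ (-j))).toMonoidHom :
        Subgroup ↥(unitaryGroupOfForm σ J)) : Set ↥(unitaryGroupOfForm σ J)) ⊆ O := by
  obtain ⟨O', hO', hsub⟩ := (mem_nhds_induced Subtype.val (1 : ↥(unitaryGroupOfForm σ J)) O).1 hO
  rw [Subgroup.coe_one] at hO'
  obtain ⟨δ, hδ⟩ := exists_congruenceGL_subset hO'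
  have hγ₁0 : min (δ : ValueGroupWithZero K) γ ≠ 0 := by
    rcases min_choice (δ : ValueGroupWithZero K) γ with h | h
    · rw [h]; exact Units.ne_zero δ
    · rw [h]; exact hγ0
  have hγ₁ : min (δ : ValueGroupWithZero K) γ < 1 := lt_of_le_of_lt (min_le_right _ _) hγ
  obtain ⟨m, hm⟩ := exists_pow_mul_le hq0 hq1 γ hγ₁0
  refine ⟨-(m : ℤ), fun y hy => ?_⟩
  have hy' : t ^ (-(m : ℤ)) * y * t ^ (-(-(m : ℤ))) ∈ ((congruenceGL N γ).comap (unitaryGroupOfForm σ J).subtype ⊓ (borelTriple σ J hJ).N ⊓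
      (unipotentRadicalGL K c).comap (unitaryGroupOfForm σ J).subtype) :=
    (mem_map_conj_zpow_neg_iff _ t _ y).1 hy
  have hre : y = t ^ m * (t ^ (-(m : ℤ)) * y * t ^ (-(-(m : ℤ)))) * (t ^ m)⁻¹ := by
    rw [neg_neg, _root_.zpow_neg, zpow_natCast]; group
  -- across blocks the conjugate gains `q^m`; within blocks the entries of `K_γ ∩ N ∩ U_c` vanish anyway
  obtain ⟨hyK, hyN⟩ := Subgroup.mem_inf.1 (Subgroup.mem_inf.1 hy').1
  have hyc := Subgroup.mem_comap.1 (Subgroup.mem_inf.1 hy').2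
  have hwqm : ∀ i j : Fin N, i < j → c i < c j → valuation K (((w ^ m) i : K) * (((w ^ m) j : K))⁻¹) ≤ q ^ m := fun i j hij hc => by
    rw [Pi.pow_apply, Pi.pow_apply, Units.val_pow_eq_pow_val, Units.val_pow_eq_pow_val, ← inv_pow, ← mul_pow, map_pow]
    exact pow_le_pow_left₀ zero_le (hwq i j hij hc) m
  obtain ⟨h1, -⟩ := diag_conj_mem_of_blockRadical σ hJ c hcm hγ₁ (t ^ m) (w ^ m) (coe_pow_eq_glDiagonal_pow σ t w ht m) hwqm hyN hyc
    (fun i j _ _ => le_trans (mul_le_mul' le_rfl (((mem_congruenceGL_iff.1 hyK).2.1) i j)) hm)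
  rw [← hre] at h1
  refine hsub ?_
  show ((y : ↥(unitaryGroupOfForm σ J)) : GL (Fin N) K) ∈ O'
  exact hδ (congruenceGL_mono (min_le_left _ _) (Subgroup.mem_inf.1 h1).1)

end RayTop

end Summit.HodgeConjecture.HodgeConjecture.Cruxes.H413.K2E3BlockRadicalRayLevels
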